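import Mathlib
import HarnessLib
import Summits.HubbardSuperconductivity.HubbardSuperconductivity.Theorems.KLProgrammeKLRegimeSplitTwoLegReadJetsStruct
import Summits.HubbardSuperconductivity.HubbardSuperconductivity.Theorems.KLProgrammeKLRegimeTwoLegReadJetDefs

/-!
# K3 under scheme F — `TwoLegReadJetBound … K n` (stub 6-F's currency) FROM FIVE SYMBOL SIZES AT THE CURVE POINTS

Cell gate-hubbard-kl, seat hubbard-kl-k3c3-p3 (g5).  The one-hop supplier form of the structured link (p526546 `…TwoLegReadJetsStruct`): the scale-`n`
reading of a frame `K` is `θ ↦ ν_n(K)(θ) = F(γ_K θ)` with the SYMBOL `F := evalM (symInterp L (klLocSelfEnergyRe L M β U μ K n))` (by definition of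
`klLocalPart`), so the engine's five numbers — the value `|F(γ_K θ)| ≤ μ₀·|U|·16^{−n}` and the BGM-shape derivative sizes `‖DˡF(γ_K θ)‖ ≤ μ_l·U²·4^{(l−2)n}`,
`1 ≤ l ≤ 4`, AT THE CURVE POINTS of an admissible frame of depth `N ≤ n` — give p2's predicate
`TwoLegReadJetBound L M (readJetC₀ μ) (readJetC' R μ) β U μ K n` with `readJetC₀ μ 0 = μ 0`, `readJetC₀ μ k = readJetC μ k` (`k ≥ 1`):

* `klLocalPart_eq_symbol_comp` — `(θ ↦ ν_n(K)(θ)) = F ∘ γ_K` (`rfl` up to `evalM`);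
* **`twoLegReadJetBound_of_symbolSizes`** — the statement above (regime `0 < c ≤ klCurveC3 R`, `0 < U ≤ min (klCurveU0 R) 1`, `klBetaMin ≤ β ≤ e^{c/U²}`,
  `μ ∈ klWindowC`; `FrameOK R U N μ K`, `N ≤ n`, `N ≤ nScales β`); under F take `K := klFlowFrameU L M β U μ n`, `N := n − 1` (`frameOK_klFlowFrameU_succ`),
  then `TwoLegReadJetBound.mono` against c4a-1's `(klC4aJetC, klC4aJetC' P R)` is the engine-flow child's fit.

Proofs only (the order-0 table is written as a lambda; no new definitions); nothing about the model is asserted.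
References: BGM 2006 §2.4 (2.36), Thm 3.1 (3.2)–(3.3) [cite: BenfattoGiulianiMastropietro2006].
-/

noncomputable section

namespace Summit.HubbardSuperconductivity.HubbardSuperconductivity.Theorems.KLRegimeSplit

set_option linter.dupNamespace false -- summit = problem name (single-conjunct summit), D-0017

open Real Finset Literature.MathematicalPhysics.QuantumLattice Literature.Probability.LatticeModels
open Summit.HubbardSuperconductivity.HubbardSuperconductivity.Theorems.DispersionFlow
open Summit.HubbardSuperconductivity.HubbardSuperconductivity.Theorems.PerturbedFermiCurve

section Model

variable {L M : ℕ} [NeZero L] [NeZero M]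

/-- **The reading is the symbol read along the curve**: `(θ ↦ ν_n(K)(θ)) = evalM (symInterp L σ_n^K) ∘ γ_K`. -/
theorem klLocalPart_eq_symbol_comp (β U μ : ℝ) (K : TrigPolyC4v) (n : ℕ) :
    (fun θ : ℝ => klLocalPart L M β U μ K n θ) =
      evalM (symInterp L (klLocSelfEnergyRe L M β U μ K n)) ∘ fun θ : ℝ => (WithLp.toLp 2 (klFermiPoint μ K θ) : Momentum) := by
  funext θ
  simp [klLocalPart, evalM, Function.comp]

variable {R : RenConsts} {c U β μ : ℝ} {K : TrigPolyC4v} {N n : ℕ} {μc : ℕ → ℝ}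

/-- **`TwoLegReadJetBound` FROM FIVE SYMBOL SIZES AT THE CURVE POINTS.**  In the regime, for an admissible frame of depth `N ≤ n` (`N ≤ nScales β`):
if the symbol `F = evalM (symInterp L σ_n^K)` of the scale-`n` reading has `|F(γ_K θ)| ≤ μc 0·|U|·4^{−2n}` and `‖DˡF(γ_K θ)‖ ≤ μc l·U²·4^{(l−2)n}`
(`1 ≤ l ≤ 4`) at every curve point, then `TwoLegReadJetBound L M (fun k => if k = 0 then μc 0 else readJetC μc k) (readJetC' R μc) β U μ K n`. -/
theorem twoLegReadJetBound_of_symbolSizes (hR : ∀ j, 0 ≤ R.Gfr j) (hc : 0 < c) (hcle : c ≤ klCurveC3 R) (hU : 0 < U)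
    (hUle : U ≤ klCurveU0 R) (hU1 : U ≤ 1) (hβmin : klBetaMin ≤ β) (hβc : β ≤ Real.exp (c / U ^ 2)) (hμ : μ ∈ klWindowC)
    (hK : FrameOK R U N μ K) (hNn : N ≤ n) (hNβ : N ≤ nScales β) (hμc : ∀ l, 0 ≤ μc l)
    (h0 : ∀ θ : ℝ, |evalM (symInterp L (klLocSelfEnergyRe L M β U μ K n)) (WithLp.toLp 2 (klFermiPoint μ K θ))| ≤
      μc 0 * |U| * (4 : ℝ) ^ ((((0 : ℕ) : ℤ) - 2) * n))
    (hm : ∀ θ : ℝ, ∀ l, 1 ≤ l → l ≤ 4 →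
      ‖iteratedFDeriv ℝ l (evalM (symInterp L (klLocSelfEnergyRe L M β U μ K n))) (WithLp.toLp 2 (klFermiPoint μ K θ))‖ ≤
        μc l * U ^ 2 * (4 : ℝ) ^ (((l : ℤ) - 2) * n)) :
    TwoLegReadJetBound L M (fun k => if k = 0 then μc 0 else readJetC μc k) (readJetC' R μc) β U μ K n := by
  have hK' : FrameOK R U (nScales β) μ K := FrameOK.mono hR hNβ hK
  obtain ⟨hA₃, hA₄⟩ := frameShift_high_sizes_of_frameOK hR hK
  have hγ := (fermiPointLp_sizes_explicit hR hc hcle hU hUle hβmin hβc hμ hK' hA₃ hA₄ 0).1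
  set F : Momentum → ℝ := evalM (symInterp L (klLocSelfEnergyRe L M β U μ K n)) with hFdef
  have hF : ContDiff ℝ 4 F := contDiff_evalM _
  have hcomp := klLocalPart_eq_symbol_comp (L := L) (M := M) β U μ K n
  refine ⟨?_, fun k hk θ => ?_⟩
  · rw [hcomp]; exact hF.comp hγ
  · rw [hcomp]
    rcases Nat.eq_zero_or_pos k with rfl | hkpos
    · -- order 0: the value
      rw [iteratedDeriv_zero, curveJetBar_apply]
      simp only [if_true, Function.comp_apply]
      have h := h0 θ
      have habs : uPow 0 U = |U| := by simp [uPow]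
      rw [habs]
      have : readJetC' R μc 0 = 0 := by simp [readJetC']
      rw [this, zero_mul, add_zero]
      exact h
    · have h := abs_iteratedDeriv_comp_fermiPointLp_le_curveJetBar hR hc hcle hU hUle hU1 hβmin hβc hμ hK hNn hNβ hF hμc θ (hm θ) hkpos hk
      refine h.trans (le_of_eq ?_)
      rw [curveJetBar_apply, curveJetBar_apply]
      simp only [show k ≠ 0 by omega, if_false]

end Model

end Summit.HubbardSuperconductivity.HubbardSuperconductivity.Theorems.KLRegimeSplit

end
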